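import Literature.Analysis.FluidPDE.TaoAveragedCascadeReduction
import Literature.Analysis.FluidPDE.TaoSymbolSeminormMeasurable
import HarnessLib

/-!
# Tao 2016, §3.2–§3.4: the symbol calculus of `𝓜₀ ⊗ ℂ` used to localise to a single scale

T. Tao, *Finite time blowup for an averaged three-dimensional Navier–Stokes equation*,
J. Amer. Math. Soc. **29** (2016), 601–674 = arXiv:1402.0290v3 (held as `paper:arxiv-1402.0290`),
§3.2 ¶3 p. 16 ("`𝓜₀ ⊗ ℂ` is closed under composition, and from (1.10) and the Leibniz rule we have
`‖m(D) m'(D)‖_k ≤ C_k Σ_{k₁ ≤ k} Σ_{k₂ ≤ k} ‖m(D)‖_{k₁} ‖m'(D)‖_{k₂}`"; "rotation and dilation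
operators normalise `𝓜₀ ⊗ ℂ`") and §3.4 pp. 16–17 ("we may smoothly localise each `m_{j,ω}` …
If we then define `m_{i,ω,n}(ξ) := m_{i,ω}((1+ε₀)^{-n} ξ)` and `m̃_{i,ω} := Σ_{n ∈ ℤ} m_{i,ω,n}`,
then the `m̃_{i,ω}(D)` are also Fourier multipliers of order `0` obeying (3.5)").

Support file for the discharge of the named fact
`Literature.Analysis.FluidPDE.Tao2016.cascade_of_singleScale` (`TaoAveragedCascadeSteps.lean`).
Everything here is proved:

* `symbolSeminorm_mul_le`, `IsComplexSymbol.mul` — **the Leibniz bound**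
  `‖m m'‖_k ≤ Σ_{i ≤ k} (k choose i) ‖m‖_i ‖m'‖_{k-i}` for the seminorms (1.10), and closure of
  `𝓜₀ ⊗ ℂ` under products;
* `seminormTerm_comp_smul_le`, `symbolSeminorm_comp_smul_le`, `IsComplexSymbol.comp_smul` —
  **dilations normalise `𝓜₀ ⊗ ℂ`**: `‖m(c ·)‖_k ≤ ‖m‖_k` (`c ≠ 0`; the seminorms are
  scale invariant);
* `shellCutoff` — the smooth radial cut-off `χ_{r,δ}(ξ) = φ((|ξ|² - r²)/δ)` to the spherical shell
  `{| |ξ|² - r² | ≤ 2δ}` (`φ` = the accepted `freqCutoff`), equal to `1` on `{| |ξ|² - r² | ≤ δ}`,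
  rotation invariant, compactly supported, and a complex order-`0` symbol
  (`isComplexSymbol_shellCutoff`);
* `periodise q g = Σ_{n ∈ ℤ} g((qⁿ)⁻¹ ·)` — Tao's `m̃ = Σₙ m((1+ε₀)^{-n} ·)` for a symbol `g`
  supported in a thin shell `{A < |ξ|² < B}`, `B < q² A`: on each scaled shell it is a single
  summand (`periodise_eq_of_mem_scaleShell`), it is `q`-multiplicatively periodic
  (`periodise_zpow_smul`), smooth off the origin with `‖periodise q g‖_k ≤ ‖g‖_k`
  (`symbolSeminorm_periodise_le`, `IsComplexSymbol.periodise`), and measurable in a parameter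
  (`measurable_periodise`).

## References

* T. Tao, J. Amer. Math. Soc. 29 (2016), 601–674, arXiv:1402.0290v3, §3.2 p. 16, §3.4 pp. 16–17.
  Key `Tao2016AveragedNS`.
-/

noncomputable section

open MeasureTheory Set Filter Topology
open scoped ENNReal NNReal

namespace Literature.Analysis.FluidPDE.Tao2016

/-- Local notation for physical / frequency space `ℝ³`. -/
local notation "ℝ³" => EuclideanSpace ℝ (Fin 3)

/-! ### The Leibniz bound (§3.2 ¶3) -/

/-- The summand of (1.10) is bounded by the seminorm, off the origin. [cite: Tao2016AveragedNS, (1.10)] -/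
theorem seminormTerm_le_symbolSeminorm (k : ℕ) (f : ℝ³ → ℂ) {ξ : ℝ³} (hξ : ξ ≠ 0) :
    seminormTerm k f ξ ≤ symbolSeminorm k f :=
  le_iSup₂ (f := fun (ξ : ℝ³) (_ : ξ ∈ ({0}ᶜ : Set ℝ³)) => seminormTerm k f ξ) ξ hξ

/-- **Leibniz bound for the symbol seminorms (1.10)** (Tao 2016, §3.2 ¶3: "from (1.10) and the
Leibniz rule we have the inequalities `‖m(D)m'(D)‖_k ≤ C_k Σ_{k₁=0}^k Σ_{k₂=0}^k ‖m(D)‖_{k₁} ‖m'(D)‖_{k₂}`"),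
in the sharper binomial form `‖m m'‖_k ≤ Σ_{i=0}^k (k choose i) ‖m‖_i ‖m'‖_{k-i}`, for symbols smooth
off the origin. [cite: Tao2016AveragedNS, §3.2 p. 16] -/
theorem symbolSeminorm_mul_le {f g : ℝ³ → ℂ} (hf : ContDiffOn ℝ ((⊤ : ℕ∞) : WithTop ℕ∞) f {0}ᶜ)
    (hg : ContDiffOn ℝ ((⊤ : ℕ∞) : WithTop ℕ∞) g {0}ᶜ) (k : ℕ) :
    symbolSeminorm k (fun ξ => f ξ * g ξ) ≤
      ∑ i ∈ Finset.range (k + 1),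
        (k.choose i : ℝ≥0∞) * (symbolSeminorm i f * symbolSeminorm (k - i) g) := by
  have hopen : IsOpen ({0}ᶜ : Set ℝ³) := isOpen_compl_singleton
  refine iSup₂_le fun ξ hξ => ?_
  have hk : ((k : ℕ∞) : WithTop ℕ∞) ≤ ((⊤ : ℕ∞) : WithTop ℕ∞) := by exact_mod_cast le_top
  -- the real Leibniz inequality, transported to `iteratedFDeriv` on the open set `{0}ᶜ`
  have hreal : ‖iteratedFDeriv ℝ k (fun ξ => f ξ * g ξ) ξ‖ ≤
      ∑ i ∈ Finset.range (k + 1), (k.choose i : ℝ) * ‖iteratedFDeriv ℝ i f ξ‖ *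
        ‖iteratedFDeriv ℝ (k - i) g ξ‖ := by
    have h := norm_iteratedFDerivWithin_mul_le hf hg hopen.uniqueDiffOn (x := ξ) hξ (n := k) hk
    rw [iteratedFDerivWithin_of_isOpen k hopen hξ] at h
    refine h.trans (le_of_eq (Finset.sum_congr rfl fun i _ => ?_))
    rw [iteratedFDerivWithin_of_isOpen i hopen hξ, iteratedFDerivWithin_of_isOpen (k - i) hopen hξ]
  have hnn : (‖iteratedFDeriv ℝ k (fun ξ => f ξ * g ξ) ξ‖₊ : ℝ≥0∞) ≤
      ∑ i ∈ Finset.range (k + 1), (k.choose i : ℝ≥0∞) * ‖iteratedFDeriv ℝ i f ξ‖₊ *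
        ‖iteratedFDeriv ℝ (k - i) g ξ‖₊ := by
    have h' : ‖iteratedFDeriv ℝ k (fun ξ => f ξ * g ξ) ξ‖₊ ≤
        ∑ i ∈ Finset.range (k + 1), (k.choose i : ℝ≥0) * ‖iteratedFDeriv ℝ i f ξ‖₊ *
          ‖iteratedFDeriv ℝ (k - i) g ξ‖₊ := by
      rw [← NNReal.coe_le_coe]
      push_cast
      exact hreal
    exact_mod_cast h'
  calc (‖ξ‖₊ : ℝ≥0∞) ^ k * ‖iteratedFDeriv ℝ k (fun ξ => f ξ * g ξ) ξ‖₊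
      ≤ (‖ξ‖₊ : ℝ≥0∞) ^ k * ∑ i ∈ Finset.range (k + 1),
          (k.choose i : ℝ≥0∞) * ‖iteratedFDeriv ℝ i f ξ‖₊ * ‖iteratedFDeriv ℝ (k - i) g ξ‖₊ := by
        gcongr
    _ = ∑ i ∈ Finset.range (k + 1), (k.choose i : ℝ≥0∞) *
          (((‖ξ‖₊ : ℝ≥0∞) ^ i * ‖iteratedFDeriv ℝ i f ξ‖₊) *
            ((‖ξ‖₊ : ℝ≥0∞) ^ (k - i) * ‖iteratedFDeriv ℝ (k - i) g ξ‖₊)) := by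
        rw [Finset.mul_sum]
        refine Finset.sum_congr rfl fun i hi => ?_
        have hik : i + (k - i) = k := Nat.add_sub_cancel' (Nat.le_of_lt_succ (Finset.mem_range.1 hi))
        have hpow : (‖ξ‖₊ : ℝ≥0∞) ^ k = (‖ξ‖₊ : ℝ≥0∞) ^ i * (‖ξ‖₊ : ℝ≥0∞) ^ (k - i) := by
          rw [← pow_add, hik]
        rw [hpow]
        ring
    _ ≤ ∑ i ∈ Finset.range (k + 1), (k.choose i : ℝ≥0∞) *
          (symbolSeminorm i f * symbolSeminorm (k - i) g) := by
        refine Finset.sum_le_sum fun i _ => ?_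
        gcongr
        · exact seminormTerm_le_symbolSeminorm i f hξ
        · exact seminormTerm_le_symbolSeminorm (k - i) g hξ

/-- **`𝓜₀ ⊗ ℂ` is closed under (pointwise) products** ("`𝓜₀ ⊗ ℂ` is closed under composition",
Tao 2016, §3.2 ¶3; the symbol of `m(D) m'(D)` is `m m'`). [cite: Tao2016AveragedNS, §3.2 p. 16] -/
theorem IsComplexSymbol.mul {f g : ℝ³ → ℂ} (hf : IsComplexSymbol f) (hg : IsComplexSymbol g) :
    IsComplexSymbol (fun ξ => f ξ * g ξ) := by
  refine ⟨hf.1.mul hg.1, fun k => lt_of_le_of_lt (symbolSeminorm_mul_le hf.1 hg.1 k) ?_⟩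
  refine ENNReal.sum_lt_top.2 fun i _ => ENNReal.mul_lt_top (by simp) ?_
  exact ENNReal.mul_lt_top (hf.2 i) (hg.2 (k - i))

/-! ### Dilations normalise `𝓜₀ ⊗ ℂ` (§3.2 ¶3) -/

/-- Precomposing with the dilation `ξ ↦ c ξ` (`c ≠ 0`) does not increase the summand of (1.10):
`|ξ|ᵏ ‖∇ᵏ(m(c·))(ξ)‖ ≤ |cξ|ᵏ ‖∇ᵏ m(cξ)‖` (chain rule: `∇ᵏ(m ∘ c)(ξ) = cᵏ ∇ᵏm(cξ)`). [cite: Tao2016AveragedNS, §3.2 p. 16] -/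
theorem seminormTerm_comp_smul_le {f : ℝ³ → ℂ} (hf : ContDiffOn ℝ ((⊤ : ℕ∞) : WithTop ℕ∞) f {0}ᶜ)
    {c : ℝ} (hc : c ≠ 0) (k : ℕ) {ξ : ℝ³} (hξ : ξ ≠ 0) :
    seminormTerm k (fun x => f (c • x)) ξ ≤ seminormTerm k f (c • ξ) := by
  have hopen : IsOpen ({0}ᶜ : Set ℝ³) := isOpen_compl_singleton
  set L : ℝ³ →L[ℝ] ℝ³ := c • ContinuousLinearMap.id ℝ ℝ³ with hL
  have hLapply : ∀ x, L x = c • x := fun x => rfl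
  have hpre : L ⁻¹' ({0}ᶜ : Set ℝ³) = {0}ᶜ := by
    ext x
    simp only [Set.mem_preimage, Set.mem_compl_iff, Set.mem_singleton_iff, hLapply,
      smul_eq_zero, hc, false_or]
  have hcomp : (fun x => f (c • x)) = f ∘ L := rfl
  have hk : ((k : ℕ∞) : WithTop ℕ∞) ≤ ((⊤ : ℕ∞) : WithTop ℕ∞) := by exact_mod_cast le_top
  have hcξ : c • ξ ≠ 0 := smul_ne_zero hc hξ
  have hLξ : L ξ ∈ ({0}ᶜ : Set ℝ³) := by simpa [hLapply] using hcξ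
  -- chain rule on the open set `{0}ᶜ`
  have hchain : iteratedFDeriv ℝ k (fun x => f (c • x)) ξ =
      (iteratedFDeriv ℝ k f (c • ξ)).compContinuousLinearMap fun _ => L := by
    have h := L.iteratedFDerivWithin_comp_right (f := f) hf hopen.uniqueDiffOn
      (by rw [hpre]; exact hopen.uniqueDiffOn) (x := ξ) hLξ (i := k) hk
    rw [hpre, iteratedFDerivWithin_of_isOpen k hopen hξ,
      iteratedFDerivWithin_of_isOpen k hopen hLξ] at h
    rw [hcomp, h, hLapply]
  have hLnorm : ‖L‖ ≤ ‖c‖ := by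
    rw [hL, norm_smul]
    exact mul_le_of_le_one_right (norm_nonneg _) ContinuousLinearMap.norm_id_le
  have hnorm : ‖iteratedFDeriv ℝ k (fun x => f (c • x)) ξ‖ ≤
      ‖iteratedFDeriv ℝ k f (c • ξ)‖ * ‖c‖ ^ k := by
    rw [hchain]
    refine (ContinuousMultilinearMap.norm_compContinuousLinearMap_le _ _).trans ?_
    rw [Finset.prod_const, Finset.card_univ, Fintype.card_fin]
    exact mul_le_mul_of_nonneg_left (pow_le_pow_left₀ (norm_nonneg _) hLnorm k) (norm_nonneg _)
  have hnn : ‖iteratedFDeriv ℝ k (fun x => f (c • x)) ξ‖₊ ≤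
      ‖iteratedFDeriv ℝ k f (c • ξ)‖₊ * ‖c‖₊ ^ k := by
    rw [← NNReal.coe_le_coe]
    push_cast
    exact hnorm
  unfold seminormTerm
  calc (‖ξ‖₊ : ℝ≥0∞) ^ k * ‖iteratedFDeriv ℝ k (fun x => f (c • x)) ξ‖₊
      ≤ (‖ξ‖₊ : ℝ≥0∞) ^ k * ((‖iteratedFDeriv ℝ k f (c • ξ)‖₊ * ‖c‖₊ ^ k : ℝ≥0) : ℝ≥0∞) :=
        mul_le_mul' le_rfl (by exact_mod_cast hnn)
    _ = (‖c • ξ‖₊ : ℝ≥0∞) ^ k * ‖iteratedFDeriv ℝ k f (c • ξ)‖₊ := by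
        rw [nnnorm_smul]
        push_cast
        ring

/-- Dilating the argument preserves smoothness off the origin. [folklore] -/
theorem contDiffOn_comp_smul_compl_zero {f : ℝ³ → ℂ} {N : WithTop ℕ∞} (hf : ContDiffOn ℝ N f {0}ᶜ)
    {c : ℝ} (hc : c ≠ 0) : ContDiffOn ℝ N (fun x => f (c • x)) {0}ᶜ :=
  hf.comp (contDiff_const_smul c).contDiffOn fun x hx => by
    simpa [smul_eq_zero, hc] using hx

/-- **Dilations normalise `𝓜₀ ⊗ ℂ`: `‖m(c ·)‖_k ≤ ‖m‖_k`** (`c ≠ 0`; by symmetry the seminorms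
(1.10) are exactly dilation invariant). [cite: Tao2016AveragedNS, §3.2 p. 16] -/
theorem symbolSeminorm_comp_smul_le {f : ℝ³ → ℂ} (hf : ContDiffOn ℝ ((⊤ : ℕ∞) : WithTop ℕ∞) f {0}ᶜ)
    {c : ℝ} (hc : c ≠ 0) (k : ℕ) : symbolSeminorm k (fun x => f (c • x)) ≤ symbolSeminorm k f :=
  iSup₂_le fun _ hξ => (seminormTerm_comp_smul_le hf hc k hξ).trans
    (seminormTerm_le_symbolSeminorm k f (smul_ne_zero hc hξ))

/-- A dilate of a complex order-`0` symbol is one. [cite: Tao2016AveragedNS, §3.2 p. 16] -/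
theorem IsComplexSymbol.comp_smul {f : ℝ³ → ℂ} (hf : IsComplexSymbol f) {c : ℝ} (hc : c ≠ 0) :
    IsComplexSymbol (fun x => f (c • x)) :=
  ⟨contDiffOn_comp_smul_compl_zero hf.1 hc, fun k => lt_of_le_of_lt (symbolSeminorm_comp_smul_le hf.1 hc k)
    (hf.2 k)⟩

/-! ### Smooth radial cut-offs to spherical shells -/

/-- The **smooth radial cut-off to the shell `{| |ξ|² - r² | ≲ δ}`**:
`χ_{r,δ}(ξ) = φ((|ξ|² - r²)/δ)` with `φ` the accepted `freqCutoff` (`= 1` on `[-1,1]`, supported in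
`[-2,2]`); used in §3.4 to "smoothly localise each `m_{j,ω}`" in frequency (the squared norm keeps
it smooth through the origin). [cite: Tao2016AveragedNS, §3.4 p. 17] -/
def shellCutoff (r δ : ℝ) (ξ : ℝ³) : ℂ := ((freqCutoff ((‖ξ‖ ^ 2 - r ^ 2) / δ) : ℝ) : ℂ)

/-- The shell cut-off is smooth on all of `ℝ³`. [folklore] -/
theorem contDiff_shellCutoff (r δ : ℝ) {N : ℕ∞} : ContDiff ℝ N (shellCutoff r δ) := by
  unfold shellCutoff
  exact Complex.ofRealCLM.contDiff.comp
    (contDiff_freqCutoff.comp (((contDiff_norm_sq ℝ).sub contDiff_const).div_const δ))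

/-- `χ_{r,δ} = 1` where `| |ξ|² - r² | ≤ δ`. [folklore] -/
theorem shellCutoff_eq_one {r δ : ℝ} (hδ : 0 < δ) {ξ : ℝ³} (h : |‖ξ‖ ^ 2 - r ^ 2| ≤ δ) :
    shellCutoff r δ ξ = 1 := by
  unfold shellCutoff
  rw [freqCutoff_eq_one, Complex.ofReal_one]
  rwa [abs_div, abs_of_pos hδ, div_le_one hδ]

/-- `χ_{r,δ} = 0` where `| |ξ|² - r² | ≥ 2δ`. [folklore] -/
theorem shellCutoff_eq_zero {r δ : ℝ} (hδ : 0 < δ) {ξ : ℝ³} (h : 2 * δ ≤ |‖ξ‖ ^ 2 - r ^ 2|) :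
    shellCutoff r δ ξ = 0 := by
  unfold shellCutoff
  rw [freqCutoff_eq_zero, Complex.ofReal_zero]
  rwa [abs_div, abs_of_pos hδ, le_div_iff₀ hδ]

/-- Where `χ_{r,δ} ≠ 0` one has `| |ξ|² - r² | < 2δ`. [folklore] -/
theorem abs_lt_of_shellCutoff_ne_zero {r δ : ℝ} (hδ : 0 < δ) {ξ : ℝ³} (h : shellCutoff r δ ξ ≠ 0) :
    |‖ξ‖ ^ 2 - r ^ 2| < 2 * δ := by
  by_contra h'
  exact h (shellCutoff_eq_zero hδ (not_lt.1 h'))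

/-- `|χ_{r,δ}| ≤ 1`. [folklore] -/
theorem norm_shellCutoff_le_one (r δ : ℝ) (ξ : ℝ³) : ‖shellCutoff r δ ξ‖ ≤ 1 := by
  unfold shellCutoff
  rw [Complex.norm_real, Real.norm_of_nonneg (freqCutoff_nonneg _)]
  exact freqCutoff_le_one _

/-- The shell cut-off is radial: it depends on `|ξ|` only (so it commutes with rotations). [folklore] -/
theorem shellCutoff_eq_of_norm_eq (r δ : ℝ) {ξ ζ : ℝ³} (h : ‖ξ‖ = ‖ζ‖) :
    shellCutoff r δ ξ = shellCutoff r δ ζ := by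
  unfold shellCutoff
  rw [h]

/-- In particular it is invariant under linear isometries. [folklore] -/
theorem shellCutoff_linearIsometryEquiv (r δ : ℝ) (R : ℝ³ ≃ₗᵢ[ℝ] ℝ³) (ξ : ℝ³) :
    shellCutoff r δ (R ξ) = shellCutoff r δ ξ :=
  shellCutoff_eq_of_norm_eq r δ (R.norm_map ξ)

/-- A vector whose squared norm is at most `M` has norm at most `max 1 M`. [folklore] -/
theorem norm_le_max_one_of_sq_le {ξ : ℝ³} {M : ℝ} (h : ‖ξ‖ ^ 2 ≤ M) : ‖ξ‖ ≤ max 1 M := by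
  by_cases h1 : ‖ξ‖ ≤ 1
  · exact h1.trans (le_max_left _ _)
  · have h1' : 1 ≤ ‖ξ‖ := le_of_not_ge h1
    calc ‖ξ‖ ≤ ‖ξ‖ ^ 2 := by nlinarith
      _ ≤ M := h
      _ ≤ max 1 M := le_max_right _ _

/-- The shell cut-off has compact support (inside `{|ξ|² ≤ r² + 2δ}`). [folklore] -/
theorem hasCompactSupport_shellCutoff (r : ℝ) {δ : ℝ} (hδ : 0 < δ) :
    HasCompactSupport (shellCutoff r δ) := by
  refine HasCompactSupport.intro (isCompact_closedBall (0 : ℝ³) (max 1 (r ^ 2 + 2 * δ)))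
    fun ξ hξ => shellCutoff_eq_zero hδ ?_
  rw [Metric.mem_closedBall, dist_zero_right, not_le] at hξ
  have h2 : r ^ 2 + 2 * δ < ‖ξ‖ ^ 2 := by
    by_contra h'
    exact (lt_irrefl _) ((norm_le_max_one_of_sq_le (not_lt.1 h')).trans_lt hξ)
  rw [abs_of_pos (by linarith)]
  linarith

/-- On the support of (any derivative of) the shell cut-off, `|ξ| ≤ max 1 (r² + 2δ)`. [folklore] -/
theorem norm_le_of_mem_tsupport_shellCutoff {r δ : ℝ} (hδ : 0 < δ) {ξ : ℝ³}
    (h : ξ ∈ tsupport (shellCutoff r δ)) : ‖ξ‖ ≤ max 1 (r ^ 2 + 2 * δ) := by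
  have hK : IsClosed {ξ : ℝ³ | ‖ξ‖ ^ 2 ≤ r ^ 2 + 2 * δ} :=
    isClosed_le (continuous_norm.pow 2) continuous_const
  have hsub : Function.support (shellCutoff r δ) ⊆ {ξ : ℝ³ | ‖ξ‖ ^ 2 ≤ r ^ 2 + 2 * δ} := by
    intro ξ hξ
    have h' := abs_lt_of_shellCutoff_ne_zero hδ (Function.mem_support.1 hξ)
    rw [abs_lt] at h'
    simp only [Set.mem_setOf_eq]
    linarith
  exact norm_le_max_one_of_sq_le (closure_minimal hsub hK h)

/-- **The shell cut-off is a complex Fourier symbol of order `0`** (smooth, compactly supported: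
all seminorms (1.10) are finite). [cite: Tao2016AveragedNS, §3.4 p. 17] -/
theorem isComplexSymbol_shellCutoff (r : ℝ) {δ : ℝ} (hδ : 0 < δ) : IsComplexSymbol (shellCutoff r δ) := by
  refine ⟨(contDiff_shellCutoff r δ).contDiffOn, fun k => ?_⟩
  set M : ℝ := max 1 (r ^ 2 + 2 * δ) with hM
  have hM0 : 0 ≤ M := zero_le_one.trans (le_max_left _ _)
  have hcont : Continuous (iteratedFDeriv ℝ k (shellCutoff r δ)) :=
    (contDiff_shellCutoff r δ (N := ⊤)).continuous_iteratedFDeriv (by exact_mod_cast le_top)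
  obtain ⟨C, hC⟩ := hcont.bounded_above_of_compact_support
    ((hasCompactSupport_shellCutoff r hδ).iteratedFDeriv k)
  have hC0 : 0 ≤ C := (norm_nonneg _).trans (hC 0)
  have hpt : ∀ ξ : ℝ³, seminormTerm k (shellCutoff r δ) ξ ≤ ENNReal.ofReal (M ^ k * C) := by
    intro ξ
    unfold seminormTerm
    by_cases h0 : iteratedFDeriv ℝ k (shellCutoff r δ) ξ = 0
    · rw [h0, nnnorm_zero, ENNReal.coe_zero, mul_zero]
      exact zero_le
    · have hξ : ‖ξ‖ ≤ M := norm_le_of_mem_tsupport_shellCutoff hδ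
        (support_iteratedFDeriv_subset k (Function.mem_support.2 h0))
      have h1 : (‖ξ‖₊ : ℝ≥0∞) ^ k * ‖iteratedFDeriv ℝ k (shellCutoff r δ) ξ‖₊ =
          ENNReal.ofReal (‖ξ‖ ^ k * ‖iteratedFDeriv ℝ k (shellCutoff r δ) ξ‖) := by
        rw [ENNReal.ofReal_mul (pow_nonneg (norm_nonneg _) _), ENNReal.ofReal_pow (norm_nonneg _),
          ofReal_norm, ofReal_norm]
        rfl
      rw [h1]
      exact ENNReal.ofReal_le_ofReal (mul_le_mul (pow_le_pow_left₀ (norm_nonneg _) hξ k) (hC ξ)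
        (norm_nonneg _) (pow_nonneg hM0 _))
  exact lt_of_le_of_lt (iSup₂_le fun ξ _ => hpt ξ) ENNReal.ofReal_lt_top

/-! ### Periodisation over the scales `qⁿ` (§3.4) -/

/-- **Tao's multi-scale symbol `m̃ = Σ_{n ∈ ℤ} m((1+ε₀)^{-n} ·)`** (§3.4, with `q = 1+ε₀`):
`periodise q g (ξ) = Σ_{n ∈ ℤ} g((qⁿ)⁻¹ ξ)` (`tsum`; for `g` supported in a thin shell at most one
summand is non-zero at each `ξ`). [cite: Tao2016AveragedNS, §3.4 p. 17] -/
def periodise (q : ℝ) (g : ℝ³ → ℂ) (ξ : ℝ³) : ℂ := ∑' n : ℤ, g ((q ^ n)⁻¹ • ξ)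

/-- **`g` is supported in the (open) spherical shell `{A < |ξ|² < B}`** (the localised symbols of
§3.4 are supported in `B(ξⱼ⁰, O(ε₀³))`, hence in such a shell). [cite: Tao2016AveragedNS, §3.4 p. 17] -/
def IsShellSupported (A B : ℝ) (g : ℝ³ → ℂ) : Prop :=
  ∀ ξ : ℝ³, g ξ ≠ 0 → A < ‖ξ‖ ^ 2 ∧ ‖ξ‖ ^ 2 < B

/-- The `n`-th **scale shell** `{B/q² < |(qⁿ)⁻¹ξ|² < q² A}`: an open neighbourhood of the support of
the `n`-th summand `g((qⁿ)⁻¹ ·)` on which all other summands vanish (when `B < q² A`). [folklore] -/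
def scaleShell (q A B : ℝ) (n : ℤ) : Set ℝ³ :=
  {ξ | B / q ^ 2 < ‖(q ^ n)⁻¹ • ξ‖ ^ 2 ∧ ‖(q ^ n)⁻¹ • ξ‖ ^ 2 < q ^ 2 * A}

/-- Scale shells are open. [folklore] -/
theorem isOpen_scaleShell (q A B : ℝ) (n : ℤ) : IsOpen (scaleShell q A B n) := by
  have hc : Continuous fun ξ : ℝ³ => ‖(q ^ n)⁻¹ • ξ‖ ^ 2 := ((continuous_const_smul _).norm).pow 2
  exact (isOpen_lt continuous_const hc).inter (isOpen_lt hc continuous_const)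

/-- Rescaling between two scales: `(q^{n'})⁻¹ ξ = (q^{n'-n})⁻¹ ((qⁿ)⁻¹ ξ)`. [folklore] -/
theorem zpow_inv_smul_eq {q : ℝ} (hq : q ≠ 0) (n n' : ℤ) (ξ : ℝ³) :
    (q ^ n')⁻¹ • ξ = (q ^ (n' - n))⁻¹ • ((q ^ n)⁻¹ • ξ) := by
  rw [smul_smul, ← mul_inv, ← zpow_add₀ hq, sub_add_cancel]

/-- The squared norm of a rescaled vector. [folklore] -/
theorem norm_zpow_inv_smul_sq {q : ℝ} (hq : 0 < q) (m : ℤ) (ζ : ℝ³) :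
    ‖(q ^ m)⁻¹ • ζ‖ ^ 2 = ((q ^ m) ^ 2)⁻¹ * ‖ζ‖ ^ 2 := by
  rw [norm_smul, norm_inv, Real.norm_of_nonneg (zpow_nonneg hq.le m), mul_pow, inv_pow]

/-- **On the `n`-th scale shell only the `n`-th summand survives**: for `g` supported in
`{A < |ξ|² < B}` with `B < q² A` (`q > 1`), `g((q^{n'})⁻¹ ξ) = 0` for `n' ≠ n` and `ξ` in the `n`-th
scale shell (the supports of the `m_{i,ω,n}` are disjoint across scales, §3.4). [cite: Tao2016AveragedNS, §3.4 p. 17] -/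
theorem apply_zpow_inv_smul_eq_zero {q A B : ℝ} (hq : 1 < q) {g : ℝ³ → ℂ} (hg : IsShellSupported A B g)
    {n n' : ℤ} (hn : n' ≠ n) {ξ : ℝ³} (hξ : ξ ∈ scaleShell q A B n) : g ((q ^ n') ⁻¹ • ξ) = 0 := by
  have hq0 : 0 < q := zero_lt_one.trans hq
  have hq1 : (1 : ℝ) ≤ q := hq.le
  obtain ⟨h1, h2⟩ := hξ
  set t : ℝ := ‖(q ^ n)⁻¹ • ξ‖ ^ 2 with ht
  have ht0 : 0 ≤ t := sq_nonneg _
  have hq2 : 0 < q ^ 2 := pow_pos hq0 2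
  by_contra hne
  obtain ⟨hA, hB⟩ := hg _ hne
  rw [zpow_inv_smul_eq hq0.ne' n n' ξ, norm_zpow_inv_smul_sq hq0, ← ht] at hA hB
  set m : ℤ := n' - n with hm
  have hm0 : m ≠ 0 := sub_ne_zero.2 hn
  have hqm : 0 < (q ^ m) ^ 2 := pow_pos (zpow_pos hq0 m) 2
  rcases lt_or_gt_of_ne hm0 with hneg | hpos
  · -- `m ≤ -1`: the rescaled point is too large
    have hle : m ≤ -1 := Int.le_sub_one_of_lt hneg
    have hqm' : (q ^ m) ^ 2 ≤ (q ^ 2)⁻¹ := by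
      rw [← zpow_natCast, ← zpow_mul, ← zpow_natCast q 2, ← zpow_neg]
      exact zpow_le_zpow_right₀ hq1 (by push_cast; linarith)
    -- `t > B/q²` and `((q^m)²)⁻¹ ≥ q²` give `((q^m)²)⁻¹ t ≥ B`
    have hge : B ≤ ((q ^ m) ^ 2)⁻¹ * t := by
      have hinv : q ^ 2 ≤ ((q ^ m) ^ 2)⁻¹ := by
        rw [le_inv_comm₀ hq2 hqm]
        exact hqm'
      calc B = q ^ 2 * (B / q ^ 2) := by field_simp
        _ ≤ ((q ^ m) ^ 2)⁻¹ * t := by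
            by_cases hB0 : 0 ≤ B
            · exact mul_le_mul hinv h1.le (div_nonneg hB0 hq2.le) (inv_nonneg.2 hqm.le)
            · have hB0' : B < 0 := not_le.1 hB0
              have : q ^ 2 * (B / q ^ 2) = B := by field_simp
              rw [this]
              exact hB0'.le.trans (mul_nonneg (inv_nonneg.2 hqm.le) ht0)
    exact (lt_irrefl _) (hB.trans_le hge)
  · -- `m ≥ 1`: the rescaled point is too small
    have hle : 1 ≤ m := hpos
    have hqm' : q ^ 2 ≤ (q ^ m) ^ 2 := by
      rw [← zpow_natCast (q ^ m), ← zpow_mul, ← zpow_natCast q 2]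
      exact zpow_le_zpow_right₀ hq1 (by push_cast; linarith)
    have hle' : ((q ^ m) ^ 2)⁻¹ * t ≤ A := by
      have hinv : ((q ^ m) ^ 2)⁻¹ ≤ (q ^ 2)⁻¹ := by
        rw [inv_le_inv₀ hqm hq2]
        exact hqm'
      calc ((q ^ m) ^ 2)⁻¹ * t ≤ (q ^ 2)⁻¹ * (q ^ 2 * A) :=
            mul_le_mul hinv h2.le ht0 (inv_nonneg.2 hq2.le)
        _ = A := by field_simp
    exact (lt_irrefl _) (hA.trans_le hle')

/-- **On the `n`-th scale shell the periodisation is the single summand `g((qⁿ)⁻¹ ξ)`.** [cite: Tao2016AveragedNS, §3.4 p. 17] -/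
theorem periodise_eq_of_mem_scaleShell {q A B : ℝ} (hq : 1 < q) {g : ℝ³ → ℂ}
    (hg : IsShellSupported A B g) {n : ℤ} {ξ : ℝ³} (hξ : ξ ∈ scaleShell q A B n) :
    periodise q g ξ = g ((q ^ n)⁻¹ • ξ) := by
  unfold periodise
  exact tsum_eq_single n fun n' hn' => apply_zpow_inv_smul_eq_zero hq hg hn' hξ

/-- **The scale shells cover the punctured space**: every `ξ ≠ 0` lies in some scale shell
(`q > 1`, `0 < A`, `B < q² A`). [folklore] -/
theorem exists_mem_scaleShell {q A B : ℝ} (hq : 1 < q) (hA : 0 < A) (hBA : B < q ^ 2 * A)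
    {ξ : ℝ³} (hξ : ξ ≠ 0) : ∃ n : ℤ, ξ ∈ scaleShell q A B n := by
  have hq0 : 0 < q := zero_lt_one.trans hq
  have hq2 : 1 < q ^ 2 := one_lt_pow₀ hq two_ne_zero
  have hq2pos : 0 < q ^ 2 := zero_lt_one.trans hq2
  have ht : 0 < ‖ξ‖ ^ 2 / A := div_pos (pow_pos (norm_pos_iff.2 hξ) 2) hA
  obtain ⟨n, hn1, hn2⟩ := exists_mem_Ico_zpow ht hq2
  refine ⟨n, ?_, ?_⟩
  · -- lower bound: `B/q² < A ≤ |(qⁿ)⁻¹ξ|²`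
    rw [norm_zpow_inv_smul_sq hq0]
    have hA' : A ≤ ((q ^ n) ^ 2)⁻¹ * ‖ξ‖ ^ 2 := by
      rw [le_div_iff₀ hA] at hn1
      rw [← zpow_natCast, ← zpow_mul, mul_comm n, zpow_mul, zpow_natCast]
      rw [le_inv_mul_iff₀ (zpow_pos hq2pos n)]
      linarith
    calc B / q ^ 2 < A := by rw [div_lt_iff₀ hq2pos]; linarith
      _ ≤ _ := hA'
  · -- upper bound: `|(qⁿ)⁻¹ξ|² < q² A`
    rw [norm_zpow_inv_smul_sq hq0]
    rw [div_lt_iff₀ hA, zpow_add_one₀ hq2pos.ne'] at hn2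
    rw [← zpow_natCast, ← zpow_mul, mul_comm n, zpow_mul, zpow_natCast,
      inv_mul_lt_iff₀ (zpow_pos hq2pos n)]
    linarith

/-- Points of a scale shell are non-zero (`0 ≤ B`). [folklore] -/
theorem ne_zero_of_mem_scaleShell {q A B : ℝ} (hB : 0 ≤ B) {n : ℤ} {ξ : ℝ³}
    (hξ : ξ ∈ scaleShell q A B n) : ξ ≠ 0 := by
  rintro rfl
  have h := hξ.1
  rw [smul_zero, norm_zero, zero_pow two_ne_zero] at h
  exact absurd h (not_lt.2 (div_nonneg hB (sq_nonneg _)))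

/-- Near a point of the `n`-th scale shell the periodisation *is* the `n`-th summand. [folklore] -/
theorem periodise_eventuallyEq {q A B : ℝ} (hq : 1 < q) {g : ℝ³ → ℂ} (hg : IsShellSupported A B g)
    {n : ℤ} {ξ : ℝ³} (hξ : ξ ∈ scaleShell q A B n) :
    periodise q g =ᶠ[𝓝 ξ] fun x => g ((q ^ n)⁻¹ • x) :=
  Filter.eventually_of_mem ((isOpen_scaleShell q A B n).mem_nhds hξ)
    fun _ hx => periodise_eq_of_mem_scaleShell hq hg hx

/-- **The periodisation of a shell-supported symbol is smooth off the origin.** [cite: Tao2016AveragedNS, §3.4 p. 17] -/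
theorem contDiffOn_periodise {q A B : ℝ} (hq : 1 < q) (hA : 0 < A) (hBA : B < q ^ 2 * A)
    {g : ℝ³ → ℂ} (hg : IsShellSupported A B g) {N : WithTop ℕ∞} (hsmooth : ContDiffOn ℝ N g {0}ᶜ) :
    ContDiffOn ℝ N (periodise q g) {0}ᶜ := by
  have hq0 : 0 < q := zero_lt_one.trans hq
  intro ξ hξ
  obtain ⟨n, hn⟩ := exists_mem_scaleShell hq hA hBA hξ
  have hc : (q ^ n)⁻¹ ≠ 0 := inv_ne_zero (zpow_ne_zero n hq0.ne')
  have hpiece : ContDiffAt ℝ N (fun x => g ((q ^ n)⁻¹ • x)) ξ :=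
    (contDiffOn_comp_smul_compl_zero hsmooth hc).contDiffAt (isOpen_compl_singleton.mem_nhds hξ)
  exact (hpiece.congr_of_eventuallyEq (periodise_eventuallyEq hq hg hn)).contDiffWithinAt

/-- **`‖m̃‖_k ≤ ‖m‖_k`: periodising a shell-supported symbol does not increase the seminorms
(1.10)** (the summands have disjoint supports and the seminorms are scale invariant; "the
`m̃_{i,ω}(D)` are also Fourier multipliers of order `0` obeying (3.5)", §3.4). [cite: Tao2016AveragedNS, §3.4 p. 17] -/
theorem symbolSeminorm_periodise_le {q A B : ℝ} (hq : 1 < q) (hA : 0 < A) (hBA : B < q ^ 2 * A)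
    {g : ℝ³ → ℂ} (hg : IsShellSupported A B g) (hsmooth : ContDiffOn ℝ ((⊤ : ℕ∞) : WithTop ℕ∞) g {0}ᶜ)
    (k : ℕ) : symbolSeminorm k (periodise q g) ≤ symbolSeminorm k g := by
  have hq0 : 0 < q := zero_lt_one.trans hq
  refine iSup₂_le fun ξ hξ => ?_
  obtain ⟨n, hn⟩ := exists_mem_scaleShell hq hA hBA hξ
  have hc : (q ^ n)⁻¹ ≠ 0 := inv_ne_zero (zpow_ne_zero n hq0.ne')
  have hder : iteratedFDeriv ℝ k (periodise q g) ξ =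
      iteratedFDeriv ℝ k (fun x => g ((q ^ n)⁻¹ • x)) ξ :=
    ((periodise_eventuallyEq hq hg hn).iteratedFDeriv ℝ k).eq_of_nhds
  calc seminormTerm k (periodise q g) ξ = seminormTerm k (fun x => g ((q ^ n)⁻¹ • x)) ξ := by
        unfold seminormTerm
        rw [hder]
    _ ≤ seminormTerm k g ((q ^ n)⁻¹ • ξ) := seminormTerm_comp_smul_le hsmooth hc k hξ
    _ ≤ symbolSeminorm k g := seminormTerm_le_symbolSeminorm k g (smul_ne_zero hc hξ)

/-- **The periodisation of a shell-supported complex order-`0` symbol is a complex order-`0`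
symbol** (§3.4: "the `m̃_{i,ω}(D)` are also Fourier multipliers of order `0`"). [cite: Tao2016AveragedNS, §3.4 p. 17] -/
theorem IsComplexSymbol.periodise {q A B : ℝ} (hq : 1 < q) (hA : 0 < A) (hBA : B < q ^ 2 * A)
    {g : ℝ³ → ℂ} (hg : IsShellSupported A B g) (hsym : IsComplexSymbol g) :
    IsComplexSymbol (periodise q g) :=
  ⟨contDiffOn_periodise hq hA hBA hg hsym.1, fun k =>
    lt_of_le_of_lt (symbolSeminorm_periodise_le hq hA hBA hg hsym.1 k) (hsym.2 k)⟩

/-- **Multiplicative periodicity**: `m̃(qᵐ ξ) = m̃(ξ)` for every `m ∈ ℤ` (reindex the sum). [cite: Tao2016AveragedNS, §3.4 p. 17] -/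
theorem periodise_zpow_smul {q : ℝ} (hq : q ≠ 0) (g : ℝ³ → ℂ) (m : ℤ) (ξ : ℝ³) :
    periodise q g (q ^ m • ξ) = periodise q g ξ := by
  unfold periodise
  have h : ∀ n : ℤ, g ((q ^ n)⁻¹ • q ^ m • ξ) = (fun n' : ℤ => g ((q ^ n')⁻¹ • ξ)) (n - m) := by
    intro n
    simp only
    rw [smul_smul, zpow_sub₀ hq, div_eq_mul_inv, mul_inv, inv_inv]
  simp_rw [h]
  exact (Equiv.subRight m).tsum_eq fun n' : ℤ => g ((q ^ n')⁻¹ • ξ)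

/-- In particular `m̃(q ξ) = m̃(ξ)` and `m̃(q⁻¹ ξ) = m̃(ξ)`. [cite: Tao2016AveragedNS, §3.4 p. 17] -/
theorem periodise_zpow_inv_smul {q : ℝ} (hq : q ≠ 0) (g : ℝ³ → ℂ) (m : ℤ) (ξ : ℝ³) :
    periodise q g ((q ^ m)⁻¹ • ξ) = periodise q g ξ := by
  rw [← zpow_neg]
  exact periodise_zpow_smul hq g (-m) ξ

/-- On the fundamental shell `{B/q² < |ξ|² < q² A}` the periodisation is `g` itself. [cite: Tao2016AveragedNS, §3.4 p. 17] -/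
theorem periodise_eq_self {q A B : ℝ} (hq : 1 < q) {g : ℝ³ → ℂ} (hg : IsShellSupported A B g)
    {ξ : ℝ³} (h1 : B / q ^ 2 < ‖ξ‖ ^ 2) (h2 : ‖ξ‖ ^ 2 < q ^ 2 * A) : periodise q g ξ = g ξ := by
  have h := periodise_eq_of_mem_scaleShell hq hg (n := 0) (ξ := ξ)
    (by simpa [scaleShell] using And.intro h1 h2)
  simpa using h

/-- **Measurability in a parameter**: for a family `g_θ` of symbols all supported in the same
shell and measurable in `θ` at each `ξ ≠ 0`, `θ ↦ periodise q g_θ (ξ)` is measurable for `ξ ≠ 0`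
(on the scale shell containing `ξ` it is a single summand). [folklore] -/
theorem measurable_periodise {Ω : Type*} [MeasurableSpace Ω] {q A B : ℝ} (hq : 1 < q) (hA : 0 < A)
    (hBA : B < q ^ 2 * A) {g : Ω → ℝ³ → ℂ} (hg : ∀ θ, IsShellSupported A B (g θ))
    (hmeas : ∀ ξ : ℝ³, ξ ≠ 0 → Measurable fun θ => g θ ξ) {ξ : ℝ³} (hξ : ξ ≠ 0) :
    Measurable fun θ => periodise q (g θ) ξ := by
  have hq0 : 0 < q := zero_lt_one.trans hq
  obtain ⟨n, hn⟩ := exists_mem_scaleShell hq hA hBA hξ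
  have h : (fun θ => periodise q (g θ) ξ) = fun θ => g θ ((q ^ n)⁻¹ • ξ) :=
    funext fun θ => periodise_eq_of_mem_scaleShell hq (hg θ) hn
  rw [h]
  exact hmeas _ (smul_ne_zero (inv_ne_zero (zpow_ne_zero n hq0.ne')) hξ)

/-- The support of the periodisation: if `m̃(ξ) ≠ 0` then some rescaling `(qⁿ)⁻¹ ξ` lies in the
shell `{A < |·|² < B}`. [folklore] -/
theorem exists_of_periodise_ne_zero {q A B : ℝ} {g : ℝ³ → ℂ} (hg : IsShellSupported A B g) {ξ : ℝ³}
    (h : periodise q g ξ ≠ 0) : ∃ n : ℤ, A < ‖(q ^ n)⁻¹ • ξ‖ ^ 2 ∧ ‖(q ^ n)⁻¹ • ξ‖ ^ 2 < B := by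
  by_contra h'
  simp only [not_exists, not_and, not_lt] at h'
  refine h ?_
  unfold periodise
  refine (tsum_congr fun n => ?_).trans tsum_zero
  by_contra hne
  obtain ⟨hA, hB⟩ := hg _ hne
  exact (lt_irrefl _) ((h' n hA).trans_lt hB)

end Literature.Analysis.FluidPDE.Tao2016
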